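import Literature.NumberTheory.EllipticCurves.ModularCurveIharaLemma
import Literature.NumberTheory.EllipticCurves.NewformsHeckeProofs
import Literature.NumberTheory.EllipticCurves.ModularSymbolsLattice
import HarnessLib

/-!
# Route `EdixhovenFibreFiveSeven`, crux TDS57 (stmt-BirchSwinnertonDyer-22227), input (L-TWIST), part (C-i):
# the NON-EISENSTEIN maximal ideal `𝔫 = (p, T_r − a_r(E))` of the prime-to-`S` Hecke ring, in the currency of
# the tree's Ihara fact `ribet1984_iharaLemma` (`--supports`, helper)

Cell `pub/bsd-wall` (D-0145 line `route-BirchSwinnertonDyer-EdixhovenFibreFiveSeven`), seat `bsd-line-edix-p3`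
(prover), part (C) of the three-seat split of (L-TWIST). THEOREMS ONLY (no top-level definition, no named fact,
no `sorry`); route-free. Nothing is closed; BSD is not proved by this file.

## What and why

Ihara's lemma in the tree (`ModularForms.ribet1984_iharaLemma`, and its three-copy variant being typed by seat
edix-p4 for part (B)) is stated at a MAXIMAL IDEAL `𝔫` of the prime-to-`S` Hecke ring
`𝕋̃ = HeckeRing0.primeTo M 2 S = ℤ[T_r : r ∤ S]` of level `M`, of odd residue characteristic and NOT
Eisenstein (`HeckeRing0.primeTo.IsEisenstein`: `T_r ≡ r + 1 (mod 𝔫)` for all primes `r ≡ 1 (mod S)`,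
Darmon–Diamond–Taylor p. 120). For the newform `f` of an elliptic curve `E` (rational eigenvalues) and a prime
`p` the relevant ideal is `𝔫 = (p, T_r − a_r(E) : r ∤ S)`, the kernel of the reduced eigencharacter. This file
constructs it — the non-Eisenstein bridge of the split (bus 2026-08-28T00:27:17Z):

* `exists_int_eigenvalue_heckeRing0` — every `t ∈ 𝕋_ℤ = ℤ[T_r : r prime]` acts on `f` by an INTEGER
  (`Algebra.adjoin` induction; `T_r f = a_r(f) f = a_r(E) f`, `IsNewform0.heckeT_eq_coeff_smul`);
* **`exists_eigenHom`** — the eigencharacter `λ : 𝕋_ℤ →+* ℤ`, `t·f = λ(t) f`, `λ(T_r) = a_r(E)`;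
* **`exists_eigenChar_not_isEisenstein`** — its reduction `χ̄ : 𝕋̃ →+* 𝔽_p` (`p` odd):
  `χ̄(s) = λ(s) mod p`, SURJECTIVE, `ker χ̄` MAXIMAL, `2 ∉ ker χ̄`, `p ∈ ker χ̄`, `T_r − a_r(E) ∈ ker χ̄` (`r ∤ S`),
  and — given ONE numeral prime `r₀ ≡ 1 (mod S)`, `r₀ ∤ S`, with `a_{r₀}(E) ≢ r₀ + 1 (mod p)` — `ker χ̄` is NOT
  Eisenstein. (The numeral follows in print from `E[p]` irreducible by Chebotarev, Darmon–Diamond–Taylor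
  Lemma 4.12 (⟸); it is kept as a hypothesis here so that this file is unconditional.)

This is the pattern of the tree's
`KimAtThreeDeepLowerOffStratumLevelLoweringVatsalIhara.exists_valuation_stabilisedSymbol_eq_one_of_ribet1984_iharaLemma`
(eigencharacter to `𝒪_{ℚ̄₃}/𝔪`), run over `ℤ → 𝔽_p` for a RATIONAL newform.

References: [DarmonDiamondTaylor1995] §4.3 (p. 119–120: `𝕋̃`, Eisenstein ideals, Lemma 4.12);
[DiamondShurman2005] Prop. 5.8.5; [Ribet1990] Thm. 5.2 (c).
-/

set_option autoImplicit false
-- the Theorems directory repeats the summit name (sibling precedent `SignedBaseChangeAssembly.lean`)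
set_option linter.dupNamespace false

noncomputable section

open scoped MatrixGroups ModularForm Classical

open CongruenceSubgroup WeierstrassCurve Literature.NumberTheory.EllipticCurves
  Literature.NumberTheory.EllipticCurves.ModularForms

namespace Summit.BirchSwinnertonDyer.BirchSwinnertonDyer.Theorems.PeriodTwistNonEisenstein

/-! ### §1 The integral eigencharacter of a rational newform on `𝕋_ℤ` -/

section Eigen

variable {M : ℕ} [NeZero M] (W : WeierstrassCurve ℚ) {f : CuspForm (Gamma0 M) 2} (hf : IsNewformOf W f)
include hf

/-- **Every element of `𝕋_ℤ = ℤ[T_r : r prime]` acts on the newform of an elliptic curve by an INTEGER**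
(induction on `Algebra.adjoin`; generators: `T_r f = a_r(f) f`, Diamond–Shurman Prop. 5.8.5, and
`a_r(f) = a_r(E) ∈ ℤ`). [cite: DiamondShurman2005, Prop. 5.8.5] -/
theorem exists_int_eigenvalue_heckeRing0 (t : HeckeRing0 M 2) :
    ∃ c : ℤ, HeckeRing0.toEnd M 2 t f = (c : ℂ) • f := by
  have ht : (HeckeRing0.toSubalgebra M 2 t : Module.End ℂ (CuspForm (Gamma0 M) 2)) ∈
      Algebra.adjoin ℤ (heckeRing0Generators M 2) := (HeckeRing0.toSubalgebra M 2 t).2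
  rw [HeckeRing0.toEnd_apply]
  refine Algebra.adjoin_induction (p := fun e _ => ∃ c : ℤ, e f = (c : ℂ) • f) ?_ ?_ ?_ ?_ ht
  · rintro e ⟨p, hp, rfl⟩
    haveI : NeZero p := ⟨hp.ne_zero⟩
    refine ⟨W.LFunction p, ?_⟩
    rw [hf.1.heckeT_eq_coeff_smul hp]
    change cuspCoeff f p • f = _
    rw [hf.2 p]
  · intro n
    refine ⟨n, ?_⟩
    rw [Algebra.algebraMap_eq_smul_one, LinearMap.smul_apply, Module.End.one_apply, Int.cast_smul_eq_zsmul]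
  · rintro e₁ e₂ _ _ ⟨c₁, h₁⟩ ⟨c₂, h₂⟩
    refine ⟨c₁ + c₂, ?_⟩
    rw [LinearMap.add_apply, h₁, h₂, ← add_smul, Int.cast_add]
  · rintro e₁ e₂ _ _ ⟨c₁, h₁⟩ ⟨c₂, h₂⟩
    refine ⟨c₁ * c₂, ?_⟩
    rw [Module.End.mul_apply, h₂, map_smul, h₁, smul_smul, mul_comm, Int.cast_mul]

/-- **The eigencharacter `λ : 𝕋_ℤ →+* ℤ` of the newform of an elliptic curve**: `t·f = λ(t)·f` for all
`t ∈ 𝕋_ℤ`, and `λ(T_r) = a_r(E)` for every prime `r` (the integer of `exists_int_eigenvalue_heckeRing0`, unique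
as `f ≠ 0`). [cite: DiamondShurman2005, Prop. 5.8.5] [cite: DarmonDiamondTaylor1995, §4.1 (p. 107)] -/
theorem exists_eigenHom :
    ∃ lam : HeckeRing0 M 2 →+* ℤ, (∀ t, HeckeRing0.toEnd M 2 t f = ((lam t : ℤ) : ℂ) • f) ∧
      ∀ (r : ℕ) (hr : r.Prime), lam (HeckeRing0.T M 2 r hr) = W.LFunction r := by
  have hf0 : f ≠ 0 := hf.1.ne_zero
  have hinj : ∀ {a b : ℤ}, ((a : ℂ)) • f = ((b : ℂ)) • f → a = b := by
    intro a b h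
    have := smul_left_injective ℂ hf0 h
    exact_mod_cast this
  choose c hc using exists_int_eigenvalue_heckeRing0 W hf
  let lam : HeckeRing0 M 2 →+* ℤ :=
    { toFun := c
      map_one' := hinj (by rw [← hc 1, map_one, Module.End.one_apply, Int.cast_one, one_smul])
      map_mul' := fun s t => hinj (by
        rw [← hc (s * t), map_mul, Module.End.mul_apply, hc t, map_smul, hc s, smul_smul, Int.cast_mul, mul_comm])
      map_zero' := hinj (by rw [← hc 0, map_zero, LinearMap.zero_apply, Int.cast_zero, zero_smul])
      map_add' := fun s t => hinj (by
        rw [← hc (s + t), map_add, LinearMap.add_apply, hc s, hc t, ← add_smul, Int.cast_add]) }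
  refine ⟨lam, fun t ↦ hc t, fun r hr ↦ hinj ?_⟩
  haveI : NeZero r := ⟨hr.ne_zero⟩
  show ((c (HeckeRing0.T M 2 r hr) : ℤ) : ℂ) • f = ((W.LFunction r : ℤ) : ℂ) • f
  rw [← hc, HeckeRing0.toEnd_T, hf.1.heckeT_eq_coeff_smul hr]
  change cuspCoeff f r • f = _
  rw [hf.2 r]

end Eigen

/-! ### §2 The reduced eigencharacter `χ̄ : 𝕋̃ → 𝔽_p` and its kernel `𝔫 = (p, T_r − a_r(E))` -/

section Reduction

variable {M : ℕ} [NeZero M] (S : ℕ) (W : WeierstrassCurve ℚ) {f : CuspForm (Gamma0 M) 2}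
  (hf : IsNewformOf W f) (p : ℕ) [hp : Fact p.Prime]
include hf

/-- **The non-Eisenstein maximal ideal of `(E, p)` in the prime-to-`S` Hecke ring.** For the newform `f` of an
elliptic curve `E`, a level-data modulus `S`, and an odd prime `p`: the reduction `χ̄ : 𝕋̃ = ℤ[T_r : r ∤ S] → 𝔽_p`
of the eigencharacter (`χ̄(s) = λ(s) mod p`; `λ` of `exists_eigenHom`, so `s·f = λ(s) f`) is SURJECTIVE with
MAXIMAL kernel `𝔫 = ker χ̄ ∋ p, T_r − a_r(E)` (`r ∤ S`), `2 ∉ 𝔫`; and if ONE prime `r₀ ≡ 1 (mod S)`, `r₀ ∤ S`,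
has `a_{r₀}(E) ≢ r₀ + 1 (mod p)`, then `𝔫` is NOT Eisenstein (Darmon–Diamond–Taylor p. 120) — the shape of
maximal ideal at which the tree's `ribet1984_iharaLemma` is stated.
[cite: DarmonDiamondTaylor1995, §4.3 (pp. 119–120) and Lemma 4.12] [cite: DiamondShurman2005, Prop. 5.8.5] -/
theorem exists_eigenChar_not_isEisenstein (hp2 : p ≠ 2) {r₀ : ℕ} (hr₀ : r₀.Prime) (hr₀S : ¬ r₀ ∣ S)
    (hr₀1 : r₀ ≡ 1 [MOD S]) (hE₀ : ¬ (p : ℤ) ∣ W.LFunction r₀ - (r₀ + 1)) :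
    ∃ (lam : HeckeRing0 M 2 →+* ℤ) (χ : HeckeRing0.primeTo M 2 S →+* ZMod p),
      (∀ t, HeckeRing0.toEnd M 2 t f = ((lam t : ℤ) : ℂ) • f) ∧
      (∀ (r : ℕ) (hr : r.Prime), lam (HeckeRing0.T M 2 r hr) = W.LFunction r) ∧
      (∀ s : HeckeRing0.primeTo M 2 S, χ s = ((lam (s : HeckeRing0 M 2) : ℤ) : ZMod p)) ∧
      Function.Surjective χ ∧ (RingHom.ker χ).IsMaximal ∧
      (2 : HeckeRing0.primeTo M 2 S) ∉ RingHom.ker χ ∧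
      ((p : HeckeRing0.primeTo M 2 S) ∈ RingHom.ker χ) ∧
      (∀ (r : ℕ) (hr : r.Prime) (hrS : ¬ r ∣ S),
        HeckeRing0.primeTo.T M 2 S hr hrS - ((W.LFunction r : ℤ) : HeckeRing0.primeTo M 2 S) ∈ RingHom.ker χ) ∧
      ¬ HeckeRing0.primeTo.IsEisenstein (RingHom.ker χ) := by
  have hpP : p.Prime := hp.out
  obtain ⟨lam, hlam, hlamT⟩ := exists_eigenHom W hf
  let χ : HeckeRing0.primeTo M 2 S →+* ZMod p :=
    ((Int.castRingHom (ZMod p)).comp lam).comp (HeckeRing0.primeTo M 2 S).val.toRingHom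
  have hχ : ∀ s : HeckeRing0.primeTo M 2 S, χ s = ((lam (s : HeckeRing0 M 2) : ℤ) : ZMod p) := fun _ ↦ rfl
  have hχT : ∀ (r : ℕ) (hr : r.Prime) (hrS : ¬ r ∣ S),
      χ (HeckeRing0.primeTo.T M 2 S hr hrS) = ((W.LFunction r : ℤ) : ZMod p) := by
    intro r hr hrS
    rw [hχ, HeckeRing0.primeTo.coe_T, hlamT r hr]
  have hsurj : Function.Surjective χ := fun z ↦ ⟨((z.val : ℤ) : HeckeRing0.primeTo M 2 S), by
    rw [map_intCast, Int.cast_natCast, ZMod.natCast_zmod_val]⟩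
  refine ⟨lam, χ, hlam, hlamT, hχ, hsurj, RingHom.ker_isMaximal_of_surjective χ hsurj, ?_, ?_, ?_, ?_⟩
  · -- `2 ∉ 𝔫`
    rw [RingHom.mem_ker, map_ofNat]
    intro h
    have h2 : (p : ℕ) ∣ 2 := (ZMod.natCast_eq_zero_iff 2 p).mp (by exact_mod_cast h)
    exact hp2 ((Nat.prime_dvd_prime_iff_eq hpP Nat.prime_two).mp h2)
  · -- `p ∈ 𝔫`
    rw [RingHom.mem_ker, map_natCast, ZMod.natCast_self]
  · -- `T_r − a_r ∈ 𝔫`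
    intro r hr hrS
    rw [RingHom.mem_ker, map_sub, hχT r hr hrS, map_intCast, sub_self]
  · -- not Eisenstein: the numeral `r₀`
    intro hEis
    have hmem := hEis r₀ hr₀ hr₀S hr₀1
    rw [RingHom.mem_ker, map_sub, hχT r₀ hr₀ hr₀S, map_add, map_natCast, map_one, sub_eq_zero] at hmem
    apply hE₀
    rw [← ZMod.intCast_zmod_eq_zero_iff_dvd]
    push_cast
    rw [hmem, sub_self]

end Reduction

end Summit.BirchSwinnertonDyer.BirchSwinnertonDyer.Theorems.PeriodTwistNonEisenstein

end
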